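import Literature.AnabelianGeometry.AbsoluteAnabelian.AbsTopIII.KummerPU
import Literature.AnabelianGeometry.AbsoluteAnabelian.AbsTopIII.KummerFaithfulPadicConsequences
import Literature.AnabelianGeometry.AbsoluteAnabelian.AbsTopIII.GeometricCyclotomeNontrivial
import HarnessLib

/-!
# [AbsTopIII] Prop. 1.6 (iii), kernel form: the universal closure of `Prop_1_6_iii_ker` is REFUTED
# (FACT-LIST F-0378; proof-only companion of `KummerPU.lean`)

Mochizuki, *Topics in Absolute Anabelian Geometry III*, §1, Prop. 1.6 (iii) p. 35 ("Suppose that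
`U = X ∖ S`, where `S ⊆ X(k)` is a finite subset. Then restricting cohomology classes of `Π_U` to the
various `I_x` for `x ∈ S` yields a natural exact sequence `1 → (k^×)^∧ → H¹(Π_U, M_X) → ⊕_{x ∈ S} Ẑ`"),
manuscript pagination (lit key `paper:url-5493eb38cbb7`).  Cell abc-iut, FACT-LIST row **F-0378**
`IntrinsicKummerModel.Prop_1_6_iii_ker` (`KummerPU.lean`, abc-iut-L4-t1), seat abc-iut-f-085 (gen 3).
PROOF-ONLY (no `def`; the model lives inside the theorem).

STATE OF THE ROW.  `Prop_1_6_iii_ker M` is the biconditional "(∀ cusps `c`, `η|_{I_c} = 0`) ⟺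
`η ∈ Ker(res_{Δ_U})`" for classes `η ∈ H¹(Π_U, M_X(Ẑ))`, a SCHEMA over the abstract interface
`M : IntrinsicKummerModel`.  `KummerPUKerProofs.lean` proved the (⇐) half for EVERY model and showed the
row equivalent to its (⇒) half; the lineage's census recorded the (⇒) half as «intrinsic `H¹` not
computable».  It is computable enough:

* `IntrinsicKummerModel.not_forall_prop_1_6_iii_ker` — **`¬ ∀ M, Prop_1_6_iii_ker M`, in every
  universe.**  Witness: the one-curve junk model over the Kummer-faithful `ULift ℚ₂`
  (`exists_isKummerFaithful_univ`) meeting every guard of the row (scheme-like, proper, genus `2`, NO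
  cusps — so "all cusps rational" and the left side hold vacuously), with extension
  `Π_U = (Ẑ × Ẑ) × G_k ↠ G_k` whose intrinsic cyclotome is NONTRIVIAL (`exists_cyclotomeMod_addChar`,
  `GeometricCyclotomeNontrivial.lean`) and with the trivial homomorphism as restriction morphism `res`
  (so `Π_U` acts trivially on `M_X`); the class of the continuous additive map `((a,b),γ) ↦ a·m`
  (`ContCohomologyTools.exists_H1_class_of_trivial_action`) has NONZERO restriction to `Δ_U`, i.e. lies
  outside `Ker(res_{Δ_U})` = the row's right side.

READING (honest scope).  This classifies OUR typing, exactly as `KummerPUSchemaNegative.lean` did for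
F-0379/F-0380: the row carries genuine content beyond the interface (it fails at junk data), so it is
consumable only as the model-relative hypothesis `M.Prop_1_6_iii_ker` — or, by
`prop_1_6_iii_ker_iff_mp`, its (⇒) half — at a coherent `M`, which is how every consumer binds it
(`Thm19PUgtProofs`, `Thm19cProofs`, …).  FACT-LIST class «universal-closure REFUTED / schema; (⇐) half
proved for every model; instance forms open».  At the intended étale-`π₁` model Prop. 1.6 (iii) is
Mochizuki's, untouched.  Nothing here bears on [IUTchIII] Cor. 3.12 or takes a side on any author.
-/

noncomputable section

namespace Literature.AnabelianGeometry.AbsoluteAnabelian.AbsTopIII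

open CategoryTheory

/-! ### F-0378: the universal closure of `Prop_1_6_iii_ker` is refuted -/

section Refutation

universe u

/-- **FACT-LIST F-0378, universal closure REFUTED (every universe).**  `∀ M, Prop_1_6_iii_ker M` is
false: over the Kummer-faithful `ULift ℚ₂` (`exists_isKummerFaithful_univ`) take the one-curve junk
`IntrinsicKummerModel` meeting every guard of the row (scheme-like, proper, genus `2`, no cusps — so
"all cusps rational" and the left side "`η|_{I_c} = 0` for every cusp" hold vacuously) whose extension
`Π_U = (Ẑ × Ẑ) × G_k ↠ G_k` has a NONTRIVIAL intrinsic cyclotome `M_X(Ẑ)`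
(`exists_cyclotomeMod_addChar`) and whose restriction morphism `res` is the trivial homomorphism (so
`Π_U` acts trivially on `M_X`); the class `η ∈ H¹(Π_U, M_X)` of the continuous additive map
`((a,b),γ) ↦ a·m` (`ContCohomologyTools.exists_H1_class_of_trivial_action`) restricts NON-trivially to
`Δ_U`, i.e. `η ∉ Ker(res_{Δ_U})` = the row's right side.  Classifies OUR typing (the row keeps genuine
content beyond the interface and is consumable only model-relatively, as every consumer binds it); at
the intended étale-`π₁` model Prop. 1.6 (iii) is untouched.  The (⇐) half stays a theorem for every
model (`prop_1_6_iii_ker_mpr`). [cite: MochizukiAbsTopIII2015, Prop 1.6 (iii) p.35] -/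
theorem IntrinsicKummerModel.not_forall_prop_1_6_iii_ker :
    ¬ ∀ M : IntrinsicKummerModel.{u}, M.Prop_1_6_iii_ker := by
  intro hall
  obtain ⟨k, _, hk⟩ := exists_isKummerFaithful_univ.{u}
  haveI : CharZero k := hk.torally.charZero
  obtain ⟨E, hgal, φ, hφ, δ, hδ⟩ := exists_cyclotomeMod_addChar (absoluteGaloisGrp k)
  -- the trivial endomorphism of the extension `E`
  let r : E ⟶ E :=
    { arith := 1, gal := 1, comm := fun x => by
        change E.aug 1 = 1
        exact map_one _ }
  let M : IntrinsicKummerModel.{u} :=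
    { Curve := PUnit.{u + 2}
      base := fun _ => k
      ext := fun _ => E
      galIso := fun _ => eqToIso hgal
      cusps := fun _ =>
        { Cusp := PEmpty.{u + 1}
          Dcusp := fun x => x.elim
          Icusp := fun x => x.elim
          Icusp_eq := fun x => x.elim
          isClosed_Dcusp := fun x => x.elim
          eq_of_conj := fun x => x.elim }
      IsProper := fun _ => True
      IsScheme := fun _ => True
      genus := fun _ => 2
      FunctionField := fun _ => k
      Point := fun _ => PEmpty.{u + 1}
      decomp := fun _ x => x.elim
      IsNFCurve := fun _ => True
      IsNFPoint := fun _ x => x.elim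
      IsNFRational := fun _ _ => True
      IsNFConstant := fun _ _ => True
      NFFunctionField := fun _ => k
      IsStrictlyBelyiType := fun _ => True
      IsCofiniteOpen := fun _ _ => True
      res := fun {_ _} _ => r
      IsRationalPt := fun _ x => x.elim
      ptSection := fun {_} x _ => x.elim
      ptSection_range := fun {_} x _ => x.elim
      ord := fun {_} x => x.elim
      kummerMap := fun {_ _} _ _ => 1 }
  have H := hall M PUnit.unit PUnit.unit trivial trivial trivial trivial le_rfl hk
    (fun c => c.elim)
  -- the `Π_U`-module `M_X` through the trivial restriction morphism: trivial action
  let A : TopRep ℤ E.arith :=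
    TopRep.res ((M.res (U := PUnit.unit) (U' := PUnit.unit) trivial).arith : E.arith →* E.arith)
      (cyclotomeModTopRep E ZHatCoeff.{u})
  have hA : ∀ (g : E.arith) (v : A), A.ρ g v = v := by
    intro g v
    change (cyclotomeModRep E ZHatCoeff.{u}) ((1 : E.arith →ₜ* E.arith) g) v = v
    rw [show (1 : E.arith →ₜ* E.arith) g = 1 from rfl, map_one]
    rfl
  obtain ⟨η, hη⟩ := ContCohomologyTools.exists_H1_class_of_trivial_action A hA φ hφ
  have hmem : η ∈ M.galoisClasses (U := PUnit.unit) (X := PUnit.unit) trivial :=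
    (H η).1 (fun c => c.elim)
  rw [IntrinsicKummerModel.mem_galoisClasses_iff] at hmem
  exact hδ (hη (subgroupInclusion E.geom) hmem δ)

end Refutation

/-! ### Robustness: the refutation survives the typed laws of Prop. 1.4 (res = identity) -/

section Lawful

universe u

/-- The split extension `Π = (Ẑ × Ẑ) × Γ ↠ Γ` of `exists_cyclotomeMod_addChar`, with the extra
information that `Δ = Ẑ × Ẑ` is CENTRAL in `Π` (so every inner automorphism of `Π` restricts to the
identity of `Δ` and `Π` acts trivially on `M(Ẑ) = Hom(H²(Δ, Ẑ), Ẑ)` through the GENUINE conjugation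
action), together with a continuous additive `φ : Π → M(Ẑ)` not vanishing on `Δ`.  (Same construction as
`exists_cyclotomeMod_addChar`; the centrality conjunct is what the identity restriction morphism needs.)
[cite: MochizukiAbsTopIII2015, Prop 1.4 (ii) p.31] -/
theorem exists_cyclotomeMod_addChar_central (Γ : ProfiniteGrp.{u}) :
    ∃ (E : FundamentalExtension.{u}) (_ : E.gal = Γ) (φ : C(E.arith, CyclotomeMod E ZHatCoeff.{u})),
      (∀ x y, φ (x * y) = φ x + φ y) ∧ (∃ δ : E.geom, φ δ ≠ 0) ∧
        ∀ (g : E.arith) (x : E.geom), g * (x : E.arith) * g⁻¹ = x := by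
  haveI : T2Space (Multiplicative ZHatCoeff.{u}) := inferInstanceAs (T2Space ZHatCoeff.{u})
  haveI : TotallyDisconnectedSpace ZHatCoeff.{u} :=
    (Homeomorph.ulift (X := ∀ p : Nat.Primes, @PadicInt (p : ℕ) ⟨p.2⟩)).symm.totallyDisconnectedSpace
  haveI : TotallyDisconnectedSpace (Multiplicative ZHatCoeff.{u}) :=
    inferInstanceAs (TotallyDisconnectedSpace ZHatCoeff.{u})
  let E : FundamentalExtension.{u} :=
    { arith := ProfiniteGrp.of ((Multiplicative ZHatCoeff.{u} × Multiplicative ZHatCoeff.{u}) × Γ)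
      gal := Γ
      aug := ContinuousMonoidHom.snd (Multiplicative ZHatCoeff.{u} × Multiplicative ZHatCoeff.{u}) Γ
      aug_surjective := fun g => ⟨(1, g), rfl⟩ }
  refine ⟨E, rfl, ?_⟩
  let pr' : E.arith →ₜ* (Multiplicative ZHatCoeff.{u} × Multiplicative ZHatCoeff.{u}) := ContinuousMonoidHom.fst (Multiplicative ZHatCoeff.{u} × Multiplicative ZHatCoeff.{u}) Γ
  let pr : E.geom →ₜ* (Multiplicative ZHatCoeff.{u} × Multiplicative ZHatCoeff.{u}) := pr'.comp (subgroupInclusion E.geom)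
  have hpr : Continuous pr := pr.continuous
  let χ : C(E.geom × E.geom, ZHatCoeff.{u}) :=
    ⟨fun q => Multiplicative.toAdd (pr q.1).1 * Multiplicative.toAdd (pr q.2).2,
      (continuous_toAdd.comp (continuous_fst.comp (hpr.comp continuous_fst))).mul
        (continuous_toAdd.comp (continuous_snd.comp (hpr.comp continuous_snd)))⟩
  have hχapp : ∀ x y : E.geom,
      χ (x, y) = Multiplicative.toAdd (pr x).1 * Multiplicative.toAdd (pr y).2 := fun _ _ => rfl
  let x₀ : E.geom := ⟨((Multiplicative.ofAdd 1, 1), 1), rfl⟩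
  let y₀ : E.geom := ⟨((1, Multiplicative.ofAdd 1), 1), rfl⟩
  have hx₀ : pr x₀ = (Multiplicative.ofAdd 1, 1) := rfl
  have hy₀ : pr y₀ = (1, Multiplicative.ofAdd 1) := rfl
  have hnt : Nontrivial (CyclotomeMod E ZHatCoeff.{u}) := by
    refine CyclotomeMod.nontrivial_of_biadditive ZHatCoeff.{u} E χ ?_ ?_ x₀ y₀ ?_ ?_
    · intro x y z
      simp only [hχapp, map_mul, Prod.fst_mul, toAdd_mul, add_mul]
    · intro x y z
      simp only [hχapp, map_mul, Prod.snd_mul, toAdd_mul, mul_add]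
    · exact Subtype.ext (Prod.ext (Prod.ext (mul_comm _ _) (mul_comm _ _)) rfl)
    · rw [hχapp, hχapp, hx₀, hy₀]
      change Multiplicative.toAdd (Multiplicative.ofAdd (1 : ZHatCoeff.{u})) *
          Multiplicative.toAdd (Multiplicative.ofAdd (1 : ZHatCoeff.{u})) ≠
        Multiplicative.toAdd (1 : Multiplicative ZHatCoeff.{u}) *
          Multiplicative.toAdd (1 : Multiplicative ZHatCoeff.{u})
      rw [toAdd_ofAdd, toAdd_one, mul_one, mul_zero]
      exact one_ne_zero
  obtain ⟨m, hm⟩ := exists_ne (0 : CyclotomeMod E ZHatCoeff.{u})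
  let φ : C(E.arith, CyclotomeMod E ZHatCoeff.{u}) :=
    ⟨fun x => CyclotomeMod.ofDual (Multiplicative.toAdd (pr' x).1 • m.toDual), by
      refine continuous_induced_rng.2 (continuous_pi fun ξ => ?_)
      exact (continuous_toAdd.comp (continuous_fst.comp pr'.continuous)).mul continuous_const⟩
  have hφapp : ∀ x, φ x = CyclotomeMod.ofDual (Multiplicative.toAdd (pr' x).1 • m.toDual) :=
    fun _ => rfl
  refine ⟨φ, fun x y => ?_, ⟨⟨((Multiplicative.ofAdd 1, 1), 1), rfl⟩, ?_⟩, ?_⟩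
  · rw [hφapp, hφapp, hφapp, map_mul, Prod.fst_mul, toAdd_mul, add_smul]
    rfl
  · rw [hφapp]
    change CyclotomeMod.ofDual
      (Multiplicative.toAdd (Multiplicative.ofAdd (1 : ZHatCoeff.{u})) • m.toDual) ≠ 0
    rw [toAdd_ofAdd, one_smul]
    exact hm
  · -- `Δ = (Ẑ × Ẑ) × 1` is central in `Π = (Ẑ × Ẑ) × Γ`
    rintro g ⟨x, hx⟩
    have hx1 : (x : (Multiplicative ZHatCoeff.{u} × Multiplicative ZHatCoeff.{u}) × Γ).2 = 1 := hx
    change (g : (Multiplicative ZHatCoeff.{u} × Multiplicative ZHatCoeff.{u}) × Γ) * x * g⁻¹ = x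
    refine Prod.ext ?_ ?_
    · change (g : (Multiplicative ZHatCoeff.{u} × Multiplicative ZHatCoeff.{u}) × Γ).1 * (x : (Multiplicative ZHatCoeff.{u} × Multiplicative ZHatCoeff.{u}) × Γ).1 * (g : (Multiplicative ZHatCoeff.{u} × Multiplicative ZHatCoeff.{u}) × Γ).1⁻¹ = (x : (Multiplicative ZHatCoeff.{u} × Multiplicative ZHatCoeff.{u}) × Γ).1
      rw [mul_comm ((g : (Multiplicative ZHatCoeff.{u} × Multiplicative ZHatCoeff.{u}) × Γ).1), mul_assoc, mul_inv_cancel, mul_one]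
    · change (g : (Multiplicative ZHatCoeff.{u} × Multiplicative ZHatCoeff.{u}) × Γ).2 * (x : (Multiplicative ZHatCoeff.{u} × Multiplicative ZHatCoeff.{u}) × Γ).2 * (g : (Multiplicative ZHatCoeff.{u} × Multiplicative ZHatCoeff.{u}) × Γ).2⁻¹ = (x : (Multiplicative ZHatCoeff.{u} × Multiplicative ZHatCoeff.{u}) × Γ).2
      rw [hx1, mul_one, mul_inv_cancel]

/-- **F-0378 refuted AT A MODEL OBEYING THE TYPED LAWS OF Prop. 1.4.**  The refutation of
`not_forall_prop_1_6_iii_ker` used the trivial homomorphism as restriction morphism `res` (legal: `res`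
is free data of the interface).  It is NOT an artifact of that freedom: here `res := 𝟙` (the identity
of `Π_U = Π_X`, `U = X` proper with no cusps), so that the model satisfies the three typed laws of
Prop. 1.4 — (i) cuspidal inertia groups free procyclic (`Prop_1_4_i`), (i') `res` surjective on `Π`,
bijective on `G`, kernel the closed normal closure of the inertia groups of a set of cusps
(`Prop_1_4_i'`, with `S = ∅`), (ii) cuspidally central extensions (`Prop_1_4_ii`) — and `Π_U` acts on
`M_X(Ẑ)` through the GENUINE conjugation action, trivial because `Δ = Ẑ × Ẑ` is central in
`Π = Δ × G_k` (`exists_cyclotomeMod_addChar_central`; `H²(c_g) = id` by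
`contCohomologyMap_congr` / `ContinuousCohomology.map_id`); still `Prop_1_6_iii_ker` FAILS (the class of
`((a,b),γ) ↦ a·m` restricts non-trivially to `Δ_U`).  So the content of the row is the ARITHMETIC input
(`G_k` acts on `Δ_X^{ab}` with nonzero weight; here it acts trivially), not the shape of the interface.
[cite: MochizukiAbsTopIII2015, Prop 1.6 (iii) p.35] -/
theorem IntrinsicKummerModel.exists_prop_1_4_laws_and_not_prop_1_6_iii_ker :
    ∃ M : IntrinsicKummerModel.{u},
      M.Prop_1_4_i ∧ M.Prop_1_4_i' ∧ M.Prop_1_4_ii ∧ ¬ M.Prop_1_6_iii_ker := by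
  obtain ⟨k, _, hk⟩ := exists_isKummerFaithful_univ.{u}
  haveI : CharZero k := hk.torally.charZero
  obtain ⟨E, hgal, φ, hφ, ⟨δ, hδ⟩, hcentral⟩ := exists_cyclotomeMod_addChar_central (absoluteGaloisGrp k)
  let M : IntrinsicKummerModel.{u} :=
    { Curve := PUnit.{u + 2}
      base := fun _ => k
      ext := fun _ => E
      galIso := fun _ => eqToIso hgal
      cusps := fun _ =>
        { Cusp := PEmpty.{u + 1}
          Dcusp := fun x => x.elim
          Icusp := fun x => x.elim
          Icusp_eq := fun x => x.elim
          isClosed_Dcusp := fun x => x.elim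
          eq_of_conj := fun x => x.elim }
      IsProper := fun _ => True
      IsScheme := fun _ => True
      genus := fun _ => 2
      FunctionField := fun _ => k
      Point := fun _ => PEmpty.{u + 1}
      decomp := fun _ x => x.elim
      IsNFCurve := fun _ => True
      IsNFPoint := fun _ x => x.elim
      IsNFRational := fun _ _ => True
      IsNFConstant := fun _ _ => True
      NFFunctionField := fun _ => k
      IsStrictlyBelyiType := fun _ => True
      IsCofiniteOpen := fun _ _ => True
      res := fun {_ _} _ => 𝟙 E
      IsRationalPt := fun _ x => x.elim
      ptSection := fun {_} x _ => x.elim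
      ptSection_range := fun {_} x _ => x.elim
      ord := fun {_} x => x.elim
      kummerMap := fun {_ _} _ _ => 1 }
  refine ⟨M, fun _ _ x => x.elim, ?_, fun _ _ _ _ _ _ x => x.elim, ?_⟩
  · -- Prop. 1.4 (i'): `res = 𝟙`, `S = ∅`
    intro U U' h _ _
    refine ⟨Function.surjective_id, Function.bijective_id, ∅, ?_⟩
    change (MonoidHom.id E.arith).ker = _
    rw [MonoidHom.ker_id, Set.biUnion_empty, Subgroup.normalClosure_empty]
    exact (le_antisymm (Subgroup.topologicalClosure_minimal _ le_rfl (by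
      rw [Subgroup.coe_bot]; exact isClosed_singleton)) bot_le).symm
  · -- `Prop_1_6_iii_ker` fails
    intro hker
    have H := hker PUnit.unit PUnit.unit trivial trivial trivial trivial le_rfl hk (fun c => c.elim)
    let A : TopRep ℤ E.arith :=
      TopRep.res ((M.res (U := PUnit.unit) (U' := PUnit.unit) trivial).arith : E.arith →* E.arith)
        (cyclotomeModTopRep E ZHatCoeff.{u})
    have hA : ∀ (g : E.arith) (v : A), A.ρ g v = v := by
      intro g v
      have hconj : geomConj E g = ContinuousMonoidHom.id E.geom := by
        ext x
        exact congrArg Subtype.val (show geomConj E g x = x from Subtype.ext (hcentral g x))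
      have hmap : geomH2Map E ZHatCoeff.{u} g = 𝟙 (geomH2 E ZHatCoeff.{u}) := by
        unfold geomH2Map
        rw [contCohomologyMap_congr hconj (geomTrivialResHom E ZHatCoeff.{u} g)
          (𝟙 (geomTrivialRep E ZHatCoeff.{u})) rfl 2]
        exact ContinuousCohomology.map_id _ 2
      change CyclotomeMod.ofDual
        ((CyclotomeMod.toDual v).comp (geomH2Map E ZHatCoeff.{u} g).hom.toLinearMap) = v
      rw [hmap]
      rfl
    obtain ⟨η, hη⟩ := ContCohomologyTools.exists_H1_class_of_trivial_action A hA φ hφ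
    have hmem : η ∈ M.galoisClasses (U := PUnit.unit) (X := PUnit.unit) trivial :=
      (H η).1 (fun c => c.elim)
    rw [IntrinsicKummerModel.mem_galoisClasses_iff] at hmem
    exact hδ (hη (subgroupInclusion E.geom) hmem δ)

end Lawful

end Literature.AnabelianGeometry.AbsoluteAnabelian.AbsTopIII
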